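import Summits.ResolutionOfSingularities.ResolutionOfSingularities.Theorems.WeightedInvariantHypersurfaceCentreAssemblyPullback
import Summits.ResolutionOfSingularities.ResolutionOfSingularities.Theorems.WeightedInvariantHypersurfaceCentreAssemblyPrimeT
import Summits.ResolutionOfSingularities.ResolutionOfSingularities.Theorems.WeightedInvariantHypersurfaceCentreAssemblyGlue
import HarnessLib

/-!
# Door assembly H2c″, stub [S6] — the EXCEPTIONAL HALF, model computation: `ι` drops along the canonical move read on a
# model of the successor's stalk

Route `ResolutionOfSingularities/WeightedInvariant`, crux `Theses.WeightedInvariant.HypersurfaceCentreConstruction`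
(stmt-ResolutionOfSingularities-19897), door line `local-engine`, registered stub [S6] `stub_iotaMax_lt_of_step`
(holder res-L1-w43-stub-9 = res-D-brk-1; plan of record `S6-PLAN.md`, EXC half).  This file is the pure-algebra core
(`iota_lt_of_plusStalk_model`); the scheme-level statement is in `…CentreAssemblyExcDrop`.

Setting (all data abstract): `A'` a localisation of `A` at a prime `𝔮`, a regular local ring essentially of finite type over a
perfect field of characteristic `p`; a position `0 ≠ f₀ ∈ 𝔪_{A'}²`; `Fch` a filtration of `A` whose pieces extend to the canonical
centre filtration `J(A', f₀)` of the game clause (c9′) `CanonicalGameClause p ι J`; `K₀ ≤ A` with `K₀ A' = (f₀)`; a prime `𝔫`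
of the coefficientwise extended Rees algebra `⊕ₙ 𝒥ₙ tⁿ` over `𝔮`, off the irrelevant ideal; a regular local ring `Sy` with a
model `Ψ₁ : Sy ≃+* (⊕ₙ 𝒥ₙ tⁿ)_𝔫` carrying a principal ideal `(gen)`, `gen ∈ 𝔪²`, onto the `t⁻¹`-saturation of `K₀`.
CONCLUSION: `ι(Sy, gen) < ι(A', f₀)`.

Proof: the game clause at `(A', f₀)` presents `J(A', f₀)` by a weighted system `(u, w)` on an r.s.p. and grants the (drop) at
every prime `𝔫'` of the carrier `A'[t⁻¹, 𝒥ₙ tⁿ]` with `t⁻¹ ∈ 𝔫' ⊇ P`, off the vertex; res-type-048's bridge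
(`exists_prime_extReesAlgebra_ringEquiv_localization_T`, `…Pullback`) produces such an `𝔫'` from `𝔫` with
`g : (⊕ₙ 𝒥ₙ tⁿ)_𝔫 ≃+* (A'[t⁻¹, 𝒥ₙ tⁿ])_{𝔫'}` (`exists_prime_bridge`; `t⁻¹ ∈ 𝔫'` is forced off the vertex over the centre);
with the factorisation `f₀ = (t⁻¹)ᵃ g₀`, `σˢ((f₀)) = (g₀)` (res-type-048, `…PrimeT`) the saturation bookkeeping shows that `gen`
and `Ψ₁⁻¹ g⁻¹ (g₀/1)` divide each other (`dvd_and_dvd_of_saturation`), whence `ι(Sy, gen) = ι(O', g₀/1)` by (c6)/(c12a) and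
`g₀/1 ∈ 𝔪²` (`iota_eq_and_mem_sq_of_dvd_dvd`), and (drop) concludes.  The local rings `(⊕ₙ 𝒥ₙ tⁿ)_𝔫` carry their ring
structure through `CommSemiring` instances, so the saturation kit is re-stated in that generality (`mem_iSup_colon_pow_iff`,
`map_iSup_colon_pow_eq`) and (c6) is instantiated at the concrete rings before being applied to `g`.

Def-free helper (`--supports stmt-ResolutionOfSingularities-19897`); OURS bookkeeping on the candidate clauses of H2a⁗ —
no claim about Hironaka's problem.  AI-written, weaker than expert review.  [cite: Wlodarczyk2022, 3.3.12 and Def. 5.1.1]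
-/

noncomputable section

set_option linter.dupNamespace false -- mandated namespace of this single-conjunct summit

open scoped LaurentPolynomial
open LaurentPolynomial CategoryTheory AlgebraicGeometry TopologicalSpace IsLocalRing
open Literature.AlgebraicGeometry.Resolution
open Summit.ResolutionOfSingularities.ResolutionOfSingularities.Theorems

namespace Summit.ResolutionOfSingularities.ResolutionOfSingularities.Cruxes.HypersurfaceCentreConstruction.LocalEngine

/-! ## Game-side algebra -/

section GameSide

variable {S : Type} [CommRing S] {n : ℕ} (u : Fin n → S) (w : Fin n → ℕ)

/-- A generator `a tᵐ` (`m ≥ 1`, `a ∈ 𝒥ₘ`) of the vertex ideal times `(t⁻¹)ᵐ` is the constant `a`. [folklore] -/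
theorem vertex_generator_mul_cobordantT'_pow {x : cobordantAlgebra' u w} {m : ℕ} {a : S}
    (hx : (x : S[T;T⁻¹]) = C a * T (m : ℤ)) : x * cobordantT' u w ^ m = algebraMap S (cobordantAlgebra' u w) a := by
  apply Subtype.ext
  simp only [MulMemClass.coe_mul, SubmonoidClass.coe_pow, hx, extReesAlgebra.coe_tInv, Subalgebra.coe_algebraMap,
    ← LaurentPolynomial.C_eq_algebraMap]
  rw [T_pow, mul_assoc, ← T_add]
  have h0 : ((m : ℤ) + (m : ℤ) * (-1)) = 0 := by ring
  rw [h0, T_zero, mul_one]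

/-- **Over a point of the centre, a prime of the game-side carrier off the vertex contains `t⁻¹`**: if `𝒥ₘ ⊆ 𝔞` for all
`m ≥ 1` (for the weighted monomial filtration of `(u, w)`: all the `uᵢ` lie in `𝔞`) and `𝔞 · S[t⁻¹, 𝒥ₙ tⁿ] ≤ 𝔫'` but the
vertex ideal is not below `𝔫'`, then `t⁻¹ ∈ 𝔫'` — every vertex generator `a tᵐ` has `(a tᵐ)(t⁻¹)ᵐ = a ∈ 𝔫'`.
[cite: Wlodarczyk2022, Def. 2.3.5] -/
theorem cobordantT'_mem_of_not_vertexIdeal_le {𝔞 : Ideal S} (hu : ∀ i, u i ∈ 𝔞) (𝔫' : Ideal (cobordantAlgebra' u w))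
    [𝔫'.IsPrime] (h𝔞 : 𝔞.map (algebraMap S (cobordantAlgebra' u w)) ≤ 𝔫')
    (hV : ¬ extReesAlgebra.vertexIdeal (weightedMonomialIdeal u w) ≤ 𝔫') : cobordantT' u w ∈ 𝔫' := by
  by_contra hT
  apply hV
  rw [extReesAlgebra.vertexIdeal, Ideal.span_le]
  rintro x ⟨m, hm, a, ha, hx⟩
  have ha' : a ∈ 𝔞 := weightedMonomialIdeal_le_of_forall_mem_of_pos u w hu hm ha
  have hmem : x * cobordantT' u w ^ m ∈ 𝔫' := by
    rw [vertex_generator_mul_cobordantT'_pow u w hx]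
    exact h𝔞 (Ideal.mem_map_of_mem _ ha')
  rcases (inferInstance : 𝔫'.IsPrime).mem_or_mem hmem with h | h
  · exact h
  · exact absurd ((inferInstance : 𝔫'.IsPrime).mem_of_pow_mem m h) hT

/-- The affine strict transform `σˢ(𝔞)` of `…WeightedResolutionDatum` IS the saturation `⋃ₘ (𝔞 · S[t⁻¹, 𝒥ₙ tⁿ] : (t⁻¹)ᵐ)`
written with colon ideals. [cite: Wlodarczyk2022, 3.3.12] -/
theorem strictTransform_eq_iSup_colon (𝔞 : Ideal S) :
    extReesAlgebra.strictTransform (weightedMonomialIdeal u w) 𝔞 =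
      ⨆ m : ℕ, (𝔞.map (algebraMap S (cobordantAlgebra' u w))).colon {cobordantT' u w ^ m} := by
  ext g
  rw [extReesAlgebra.mem_strictTransform_iff, mem_iSup_ideal_colon_singleton_pow_iff]

/-! ### Saturations over commutative SEMIrings (the localisations `(⊕ₙ 𝒥ₙ tⁿ)_𝔫` carry their instances through
`CommSemiring`, so the `CommRing`-stated kit of `…Pullback` is re-stated here in that generality) -/

/-- Membership in `⋃ₙ (J : tⁿ)`. [folklore] -/
theorem mem_iSup_colon_pow_iff {R : Type*} [CommSemiring R] (J : Ideal R) (t x : R) :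
    x ∈ (⨆ n : ℕ, J.colon {t ^ n}) ↔ ∃ n : ℕ, t ^ n * x ∈ J := by
  have hmono : Monotone fun n : ℕ => J.colon {t ^ n} := by
    refine monotone_nat_of_le_succ fun n f hf => ?_
    rw [Submodule.mem_colon_singleton, smul_eq_mul] at hf ⊢
    rw [pow_succ, ← mul_assoc]
    exact Ideal.mul_mem_right _ _ hf
  rw [Submodule.mem_iSup_of_directed _ hmono.directed_le]
  simp only [Submodule.mem_colon_singleton, smul_eq_mul, mul_comm x]

/-- **Saturation commutes with localisation at a prime** (commutative semirings): `(⋃ₙ (J : tⁿ)) O = ⋃ₙ (J O : (t/1)ⁿ)`.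
[folklore] -/
theorem map_iSup_colon_pow_eq {R : Type*} [CommSemiring R] (𝔫 : Ideal R) [𝔫.IsPrime] (O : Type*) [CommSemiring O]
    [Algebra R O] [IsLocalization.AtPrime O 𝔫] (J : Ideal R) (t : R) :
    (⨆ n : ℕ, J.colon {t ^ n}).map (algebraMap R O) =
      ⨆ n : ℕ, (J.map (algebraMap R O)).colon {algebraMap R O t ^ n} := by
  apply le_antisymm
  · rw [Ideal.map_le_iff_le_comap]
    intro x hx
    rw [Ideal.mem_comap, mem_iSup_colon_pow_iff]
    obtain ⟨n, hn⟩ := (mem_iSup_colon_pow_iff J t x).mp hx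
    exact ⟨n, by rw [← map_pow, ← map_mul]; exact Ideal.mem_map_of_mem _ hn⟩
  · intro z hz
    obtain ⟨n, hn⟩ := (mem_iSup_colon_pow_iff _ _ z).mp hz
    obtain ⟨⟨x, s⟩, rfl⟩ := IsLocalization.mk'_surjective 𝔫.primeCompl z
    have hmem : IsLocalization.mk' O (t ^ n * x) s ∈ J.map (algebraMap R O) := by
      rw [IsLocalization.mk'_eq_mul_mk'_one, map_mul, map_pow, mul_assoc, ← IsLocalization.mk'_eq_mul_mk'_one]
      exact hn
    rw [IsLocalization.mk'_mem_map_algebraMap_iff 𝔫.primeCompl] at hmem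
    obtain ⟨c, hc, hcx⟩ := hmem
    have hcx' : c * x ∈ J.colon {t ^ n} := by
      rw [Submodule.mem_colon_singleton, smul_eq_mul]
      have : c * x * t ^ n = c * (t ^ n * x) := by ring
      rw [this]; exact hcx
    have hxmem : c * x ∈ ⨆ n : ℕ, J.colon {t ^ n} := Submodule.mem_iSup_of_mem n hcx'
    have hunit : IsUnit (algebraMap R O c) := IsLocalization.map_units O ⟨c, hc⟩
    rw [← Ideal.unit_mul_mem_iff_mem _ hunit, IsLocalization.mul_mk'_eq_mk'_of_mul]
    exact IsLocalization.mk'_mem_iff.mpr (Ideal.mem_map_of_mem _ hxmem)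

end GameSide

/-! ## The exceptional half of [S6]: the model computation, in three steps -/

section ExcModel

variable {p : ℕ} (ι : (R : Type) → [CommRing R] → R → Ordinal.{0})
  (J : (R : Type) → [CommRing R] → R → ℕ → Ideal R)

/-- **Step 1 — res-type-048's chart-to-game bridge at a prime over the centre.**  For a localisation `A'` of `A` at `𝔮`, a
filtration `Fch` of `A` whose pieces extend to the weighted monomial filtration of `(u, w)` on `A'` (all `uᵢ ∈ 𝔪_{A'}`), an
ideal `K₀ ≤ A` extending to `(f₀)`, and a prime `𝔫` of `⊕ₙ 𝒥ₙ tⁿ` over `𝔮` off the irrelevant ideal: a prime `𝔫'` of the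
game-side carrier `A'[t⁻¹, 𝒥ₙ tⁿ]` containing `t⁻¹` and `𝔪_{A'}`, off the vertex, with `(⊕ₙ 𝒥ₙ tⁿ)_𝔫 ≃+* (A'[t⁻¹, 𝒥ₙ tⁿ])_{𝔫'}`
carrying `t⁻¹/1 ↦ t⁻¹/1` and `K₀ ↦ (f₀)` (`exists_prime_extReesAlgebra_ringEquiv_localization_T` of `…Pullback`; `t⁻¹ ∈ 𝔫'` by
`cobordantT'_mem_of_not_vertexIdeal_le`). [cite: Wlodarczyk2022, Def. 5.1.1] -/
theorem exists_prime_bridge {A : Type} [CommRing A] (𝔮 : Ideal A) [𝔮.IsPrime]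
    {A' : Type} [CommRing A'] [Algebra A A'] [IsLocalization.AtPrime A' 𝔮] [IsLocalRing A']
    (Fch : IdealFiltration A) (K₀ : Ideal A) {f₀ : A'} (hK₀ : K₀.map (algebraMap A A') = Ideal.span {f₀})
    (𝔫 : Ideal Fch.extendedRees) [𝔫.IsPrime] (hII : 𝔫.comap (algebraMap A Fch.extendedRees) = 𝔮)
    (hIII : ¬ Fch.irrelevant ≤ 𝔫) {n : ℕ} (u : Fin n → A') (w : Fin n → ℕ) (hu𝔪 : ∀ i, u i ∈ maximalIdeal A')
    (hI' : ∀ m, weightedMonomialIdeal u w m = (Fch.ideal m).map (algebraMap A A')) :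
    ∃ (𝔫' : Ideal (cobordantAlgebra' u w)) (_ : 𝔫'.IsPrime)
      (g : Localization.AtPrime 𝔫 ≃+* Localization.AtPrime 𝔫'),
      cobordantT' u w ∈ 𝔫' ∧ (maximalIdeal A').map (algebraMap A' (cobordantAlgebra' u w)) ≤ 𝔫' ∧
      ¬ extReesAlgebra.vertexIdeal (weightedMonomialIdeal u w) ≤ 𝔫' ∧
      g (algebraMap Fch.extendedRees (Localization.AtPrime 𝔫) ⟨T (-1), Fch.T_neg_one_mem_extendedRees⟩) =
        algebraMap (cobordantAlgebra' u w) (Localization.AtPrime 𝔫') (cobordantT' u w) ∧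
      ((K₀.map (algebraMap A Fch.extendedRees)).map (algebraMap Fch.extendedRees (Localization.AtPrime 𝔫))).map
          (g : Localization.AtPrime 𝔫 →+* Localization.AtPrime 𝔫') =
        ((Ideal.span {f₀}).map (algebraMap A' (cobordantAlgebra' u w))).map
          (algebraMap (cobordantAlgebra' u w) (Localization.AtPrime 𝔫')) := by
  -- the prime `𝔫` lies over `𝔮`
  have hd : Disjoint ((𝔮.primeCompl.map (algebraMap A Fch.extendedRees) : Submonoid Fch.extendedRees) :
      Set Fch.extendedRees) (𝔫 : Set Fch.extendedRees) := by
    refine Set.disjoint_left.mpr ?_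
    rintro x ⟨a, ha, rfl⟩ hx
    exact ha (show a ∈ 𝔮 by rw [← hII]; exact hx)
  obtain ⟨𝔫', h𝔫', g, hgi, -, hgiii, hgiv, hgv⟩ :=
    exists_prime_extReesAlgebra_ringEquiv_localization_T Fch 𝔮.primeCompl (I' := weightedMonomialIdeal u w) hI' 𝔫 hd
  haveI := h𝔫'
  have hV' : ¬ extReesAlgebra.vertexIdeal (weightedMonomialIdeal u w) ≤ 𝔫' := fun h => hIII (hgiii.mp h)
  have h𝔮𝔫 : 𝔮.map (algebraMap A Fch.extendedRees) ≤ 𝔫 := by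
    rw [← hII]; exact Ideal.map_comap_le
  have hmax : (maximalIdeal A').map (algebraMap A' (cobordantAlgebra' u w)) ≤ 𝔫' := by
    rw [← IsLocalization.AtPrime.map_eq_maximalIdeal 𝔮 A']
    exact (hgiv 𝔮).mpr h𝔮𝔫
  have hT' : cobordantT' u w ∈ 𝔫' := cobordantT'_mem_of_not_vertexIdeal_le u w hu𝔪 𝔫' hmax hV'
  refine ⟨𝔫', h𝔫', g, hT', hmax, hV', hgv, ?_⟩
  -- `g` carries `K₀ · (⊕ₙ 𝒥ₙ tⁿ)_𝔫` onto `(f₀) · (A'[t⁻¹, 𝒥ₙ tⁿ])_{𝔫'}`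
  have hgi' : ∀ x, (g : Localization.AtPrime 𝔫 →+* Localization.AtPrime 𝔫')
      (algebraMap Fch.extendedRees (Localization.AtPrime 𝔫) (algebraMap A Fch.extendedRees x)) =
      algebraMap (cobordantAlgebra' u w) (Localization.AtPrime 𝔫')
        (algebraMap A' (cobordantAlgebra' u w) (algebraMap A A' x)) := fun x => by
    rw [RingHom.coe_coe]
    exact hgi x
  have hcomp : ((g : Localization.AtPrime 𝔫 →+* Localization.AtPrime 𝔫').comp
      (algebraMap Fch.extendedRees (Localization.AtPrime 𝔫))).comp (algebraMap A Fch.extendedRees) =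
      ((algebraMap (cobordantAlgebra' u w) (Localization.AtPrime 𝔫')).comp
        (algebraMap A' (cobordantAlgebra' u w))).comp (algebraMap A A') := RingHom.ext hgi'
  rw [← hK₀, Ideal.map_map, Ideal.map_map, Ideal.map_map, Ideal.map_map, hcomp]

/-- **Step 2 — the local equation of the model and `g₀/1` divide each other.**  With `g` as in step 1, the affine strict
transform `σˢ((f₀)) = (g₀)` on the game side, and `Ψ₁ : Sy ≃+* (⊕ₙ 𝒥ₙ tⁿ)_𝔫` carrying `(gen)` onto the `t⁻¹`-saturation of
`K₀`: `gen` and `Ψ₁⁻¹(g⁻¹(g₀/1))` divide each other in `Sy` — (G1) `(t⁻¹)ᵐ g₀ ∈ (f₀)` upstairs pulls back along `g` into the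
saturation downstairs; (G2) `(t⁻¹/1)ᵐ Ψ₁(gen) ∈ K₀` pushes along `g` and un-saturates by localising `σˢ((f₀)) = (g₀)`
(`map_iSup_colon_pow_eq`). [cite: Wlodarczyk2022, 3.3.12] -/
theorem dvd_and_dvd_of_saturation {A : Type} [CommRing A] {A' : Type} [CommRing A'] [Algebra A A']
    (Fch : IdealFiltration A) (K₀ : Ideal A) {f₀ : A'} (𝔫 : Ideal Fch.extendedRees) [𝔫.IsPrime]
    {n : ℕ} (u : Fin n → A') (w : Fin n → ℕ) (𝔫' : Ideal (cobordantAlgebra' u w)) [𝔫'.IsPrime]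
    (g : Localization.AtPrime 𝔫 ≃+* Localization.AtPrime 𝔫')
    (hgv : g (algebraMap Fch.extendedRees (Localization.AtPrime 𝔫) ⟨T (-1), Fch.T_neg_one_mem_extendedRees⟩) =
      algebraMap (cobordantAlgebra' u w) (Localization.AtPrime 𝔫') (cobordantT' u w))
    (hJmap : ((K₀.map (algebraMap A Fch.extendedRees)).map
        (algebraMap Fch.extendedRees (Localization.AtPrime 𝔫))).map
          (g : Localization.AtPrime 𝔫 →+* Localization.AtPrime 𝔫') =
      ((Ideal.span {f₀}).map (algebraMap A' (cobordantAlgebra' u w))).map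
        (algebraMap (cobordantAlgebra' u w) (Localization.AtPrime 𝔫')))
    {g₀ : cobordantAlgebra' u w}
    (hst : extReesAlgebra.strictTransform (weightedMonomialIdeal u w) (Ideal.span {f₀}) = Ideal.span {g₀})
    {Sy : Type} [CommRing Sy] (Ψ₁ : Sy ≃+* Localization.AtPrime 𝔫) {gen : Sy}
    (hI : (Ideal.span {gen}).map (Ψ₁ : Sy →+* Localization.AtPrime 𝔫) =
      ⨆ m : ℕ, ((K₀.map (algebraMap A Fch.extendedRees)).map
        (algebraMap Fch.extendedRees (Localization.AtPrime 𝔫))).colon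
        {algebraMap Fch.extendedRees (Localization.AtPrime 𝔫) ⟨T (-1), Fch.T_neg_one_mem_extendedRees⟩ ^ m}) :
    gen ∣ Ψ₁.symm (g.symm (algebraMap (cobordantAlgebra' u w) (Localization.AtPrime 𝔫') g₀)) ∧
      Ψ₁.symm (g.symm (algebraMap (cobordantAlgebra' u w) (Localization.AtPrime 𝔫') g₀)) ∣ gen := by
  -- `g.symm` undoes `g` on ideals and carries `t⁻¹/1` back
  have hcomp2 : ((g.symm : Localization.AtPrime 𝔫' →+* Localization.AtPrime 𝔫)).comp
      (g : Localization.AtPrime 𝔫 →+* Localization.AtPrime 𝔫') = RingHom.id _ :=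
    RingHom.ext fun x => by simp
  have hback : ((((K₀.map (algebraMap A Fch.extendedRees)).map
      (algebraMap Fch.extendedRees (Localization.AtPrime 𝔫))).map
        (g : Localization.AtPrime 𝔫 →+* Localization.AtPrime 𝔫')).map
        (g.symm : Localization.AtPrime 𝔫' →+* Localization.AtPrime 𝔫)) =
      (K₀.map (algebraMap A Fch.extendedRees)).map (algebraMap Fch.extendedRees (Localization.AtPrime 𝔫)) := by
    rw [Ideal.map_map, hcomp2, Ideal.map_id]
  have hgvs : g.symm (algebraMap (cobordantAlgebra' u w) (Localization.AtPrime 𝔫') (cobordantT' u w)) =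
      algebraMap Fch.extendedRees (Localization.AtPrime 𝔫) ⟨T (-1), Fch.T_neg_one_mem_extendedRees⟩ := by
    rw [← hgv, RingEquiv.symm_apply_apply]
  constructor
  · -- (G1)
    obtain ⟨m, hm⟩ : ∃ m, cobordantT' u w ^ m * g₀ ∈
        (Ideal.span {f₀}).map (algebraMap A' (cobordantAlgebra' u w)) := by
      have h := Ideal.mem_span_singleton_self g₀
      rw [← hst, extReesAlgebra.mem_strictTransform_iff] at h
      exact h
    have hm' : algebraMap Fch.extendedRees (Localization.AtPrime 𝔫) ⟨T (-1), Fch.T_neg_one_mem_extendedRees⟩ ^ m *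
        g.symm (algebraMap (cobordantAlgebra' u w) (Localization.AtPrime 𝔫') g₀) ∈
        (K₀.map (algebraMap A Fch.extendedRees)).map (algebraMap Fch.extendedRees (Localization.AtPrime 𝔫)) := by
      have h1 := Ideal.mem_map_of_mem (algebraMap (cobordantAlgebra' u w) (Localization.AtPrime 𝔫')) hm
      rw [← hJmap] at h1
      have h2 := Ideal.mem_map_of_mem (g.symm : Localization.AtPrime 𝔫' →+* Localization.AtPrime 𝔫) h1
      rw [hback] at h2
      simpa only [RingHom.coe_coe, map_mul, map_pow, hgvs] using h2
    have h1 : g.symm (algebraMap (cobordantAlgebra' u w) (Localization.AtPrime 𝔫') g₀) ∈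
        (Ideal.span {gen}).map (Ψ₁ : Sy →+* Localization.AtPrime 𝔫) := by
      rw [hI, mem_iSup_colon_pow_iff]
      exact ⟨m, hm'⟩
    rw [Ideal.map_span, Set.image_singleton, Ideal.mem_span_singleton, RingHom.coe_coe] at h1
    have h2 := map_dvd (Ψ₁.symm : Localization.AtPrime 𝔫 →+* Sy) h1
    simpa only [RingHom.coe_coe, RingEquiv.symm_apply_apply] using h2
  · -- (G2)
    obtain ⟨m₂, hm₂⟩ : ∃ m₂, algebraMap Fch.extendedRees (Localization.AtPrime 𝔫)
        ⟨T (-1), Fch.T_neg_one_mem_extendedRees⟩ ^ m₂ * Ψ₁ gen ∈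
        (K₀.map (algebraMap A Fch.extendedRees)).map (algebraMap Fch.extendedRees (Localization.AtPrime 𝔫)) := by
      have h := Ideal.mem_map_of_mem (Ψ₁ : Sy →+* Localization.AtPrime 𝔫) (Ideal.mem_span_singleton_self gen)
      rw [hI, mem_iSup_colon_pow_iff, RingHom.coe_coe] at h
      exact h
    have h1 := Ideal.mem_map_of_mem (g : Localization.AtPrime 𝔫 →+* Localization.AtPrime 𝔫') hm₂
    rw [map_mul, map_pow, hJmap, RingHom.coe_coe, hgv] at h1
    have h2 : g (Ψ₁ gen) ∈ (extReesAlgebra.strictTransform (weightedMonomialIdeal u w) (Ideal.span {f₀})).map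
        (algebraMap (cobordantAlgebra' u w) (Localization.AtPrime 𝔫')) := by
      rw [strictTransform_eq_iSup_colon, map_iSup_colon_pow_eq 𝔫' (Localization.AtPrime 𝔫'), mem_iSup_colon_pow_iff]
      exact ⟨m₂, h1⟩
    rw [hst, Ideal.map_span, Set.image_singleton, Ideal.mem_span_singleton] at h2
    have h3 := map_dvd (Ψ₁.symm : Localization.AtPrime 𝔫 →+* Sy)
      (map_dvd (g.symm : Localization.AtPrime 𝔫' →+* Localization.AtPrime 𝔫) h2)
    simpa only [RingHom.coe_coe, RingEquiv.symm_apply_apply] using h3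

/-- **Step 3 — reading `ι` and `𝔪²` through `g ∘ Ψ₁`.**  If `gen ∈ 𝔪_{Sy}²` and `Ψ₁⁻¹(g⁻¹ γ)` divide each other in the
regular local ring `Sy`, then `ι(Sy, gen) = ι((A'[t⁻¹, 𝒥ₙ tⁿ])_{𝔫'}, γ)` ((c6) along `g` and `Ψ₁` — instantiated at the
concrete rings before being applied — and (c12a) for the unit) and `γ ∈ 𝔪²` (local homomorphisms). [folklore] -/
theorem iota_eq_and_mem_sq_of_dvd_dvd (hc6 : IotaIsoInvariant ι) (hu : IotaUnitInvariant ι)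
    {A : Type} [CommRing A] {A' : Type} [CommRing A'] (Fch : IdealFiltration A) (𝔫 : Ideal Fch.extendedRees)
    [𝔫.IsPrime] {n : ℕ} (u : Fin n → A') (w : Fin n → ℕ) (𝔫' : Ideal (cobordantAlgebra' u w)) [𝔫'.IsPrime]
    (g : Localization.AtPrime 𝔫 ≃+* Localization.AtPrime 𝔫') {Sy : Type} [CommRing Sy] [IsRegularLocalRing Sy]
    (Ψ₁ : Sy ≃+* Localization.AtPrime 𝔫) {gen : Sy} (hgen2 : gen ∈ maximalIdeal Sy ^ 2)
    (γ : Localization.AtPrime 𝔫') (hd1 : gen ∣ Ψ₁.symm (g.symm γ)) (hd2 : Ψ₁.symm (g.symm γ) ∣ gen) :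
    ι Sy gen = ι (Localization.AtPrime 𝔫') γ ∧ γ ∈ maximalIdeal (Localization.AtPrime 𝔫') ^ 2 := by
  haveI : IsDomain Sy := isDomain_of_isRegularLocalRing Sy
  obtain ⟨v, hv⟩ := associated_of_dvd_dvd hd1 hd2
  have hgx : g (Ψ₁ (Ψ₁.symm (g.symm γ))) = γ := by
    rw [RingEquiv.apply_symm_apply, RingEquiv.apply_symm_apply]
  constructor
  · have h6 := hc6 (Localization.AtPrime 𝔫) (Localization.AtPrime 𝔫')
    have h6' := hc6 Sy (Localization.AtPrime 𝔫)
    have hι1 : ι (Localization.AtPrime 𝔫') (g (Ψ₁ (Ψ₁.symm (g.symm γ)))) =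
        ι (Localization.AtPrime 𝔫) (Ψ₁ (Ψ₁.symm (g.symm γ))) := h6 g _
    have hι2 : ι (Localization.AtPrime 𝔫) (Ψ₁ (Ψ₁.symm (g.symm γ))) = ι Sy (Ψ₁.symm (g.symm γ)) := h6' Ψ₁ _
    have hι3 : ι Sy (Ψ₁.symm (g.symm γ)) = ι Sy gen := by
      rw [← hv, mul_comm]
      exact hu Sy (v : Sy) gen v.isUnit
    rw [← hι3, ← hι2, ← hι1, hgx]
  · have hΦm : (maximalIdeal Sy).map (((g : Localization.AtPrime 𝔫 →+* Localization.AtPrime 𝔫')).comp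
        (Ψ₁ : Sy →+* Localization.AtPrime 𝔫)) ≤ maximalIdeal (Localization.AtPrime 𝔫') := by
      refine Ideal.map_le_iff_le_comap.mpr fun x hx => ?_
      rw [Ideal.mem_comap]
      rw [IsLocalRing.mem_maximalIdeal, mem_nonunits_iff] at hx ⊢
      intro hux
      apply hx
      have h := (hux.map g.symm).map Ψ₁.symm
      simpa only [RingHom.comp_apply, RingHom.coe_coe, RingEquiv.symm_apply_apply] using h
    have hx₀ : Ψ₁.symm (g.symm γ) ∈ maximalIdeal Sy ^ 2 := by
      rw [← hv]
      exact Ideal.mul_mem_right _ _ hgen2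
    have h := Ideal.mem_map_of_mem (((g : Localization.AtPrime 𝔫 →+* Localization.AtPrime 𝔫')).comp
      (Ψ₁ : Sy →+* Localization.AtPrime 𝔫)) hx₀
    rw [Ideal.map_pow, RingHom.comp_apply, RingHom.coe_coe, RingHom.coe_coe, hgx] at h
    exact Ideal.pow_right_mono hΦm 2 h

/-- **[S6], EXCEPTIONAL HALF — model form.**  Let `(A', f₀)` be an e.f.t. regular local position over a perfect field of
characteristic `p` (`A'` a localisation of `A` at the prime `𝔮`, `0 ≠ f₀ ∈ 𝔪²`), `Fch` a filtration of `A` whose pieces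
extend to the canonical centre filtration `J(A', f₀)`, `K₀ ≤ A` an ideal extending to `(f₀)`, and `𝔫` a prime of the
coefficientwise extended Rees algebra `⊕ₙ 𝒥ₙ tⁿ` over `𝔮` and off the irrelevant ideal.  If a regular local ring `Sy` is
modelled by `(⊕ₙ 𝒥ₙ tⁿ)_𝔫` along `Ψ₁`, carrying the principal ideal `(gen)`, `gen ∈ 𝔪_{Sy}²`, onto the `t⁻¹`-saturation
of `K₀ · (⊕ₙ 𝒥ₙ tⁿ)_𝔫`, then `ι(Sy, gen) < ι(A', f₀)`: the (drop) clause of the canonical game at `(A', f₀)` at the prime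
of step 1, with the factorisation `f₀ = (t⁻¹)ᵃ g₀`, `σˢ((f₀)) = (g₀)` (`…PrimeT`), read through steps 2 and 3.
[cite: Wlodarczyk2022, 3.3.12 and Def. 5.1.1] -/
theorem iota_lt_of_plusStalk_model (hc6 : IotaIsoInvariant ι) (hu : IotaUnitInvariant ι)
    (hgame : CanonicalGameClause p ι J) (k : Type) [Field k] [CharP k p] [PerfectField k]
    {A : Type} [CommRing A] (𝔮 : Ideal A) [𝔮.IsPrime]
    {A' : Type} [CommRing A'] [Algebra A A'] [IsLocalization.AtPrime A' 𝔮] [IsRegularLocalRing A']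
    [Algebra k A'] [Algebra.EssFiniteType k A']
    {f₀ : A'} (hf0 : f₀ ≠ 0) (hf2 : f₀ ∈ maximalIdeal A' ^ 2)
    (Fch : IdealFiltration A) (hFJ : ∀ m, (Fch.ideal m).map (algebraMap A A') = J A' f₀ m)
    (K₀ : Ideal A) (hK₀ : K₀.map (algebraMap A A') = Ideal.span {f₀})
    (𝔫 : Ideal Fch.extendedRees) [𝔫.IsPrime] (hII : 𝔫.comap (algebraMap A Fch.extendedRees) = 𝔮)
    (hIII : ¬ Fch.irrelevant ≤ 𝔫)
    {Sy : Type} [CommRing Sy] [IsRegularLocalRing Sy] (Ψ₁ : Sy ≃+* Localization.AtPrime 𝔫)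
    {gen : Sy} (hgen2 : gen ∈ maximalIdeal Sy ^ 2)
    (hI : (Ideal.span {gen}).map (Ψ₁ : Sy →+* Localization.AtPrime 𝔫) =
      ⨆ m : ℕ, ((K₀.map (algebraMap A Fch.extendedRees)).map
        (algebraMap Fch.extendedRees (Localization.AtPrime 𝔫))).colon
        {algebraMap Fch.extendedRees (Localization.AtPrime 𝔫) ⟨T (-1), Fch.T_neg_one_mem_extendedRees⟩ ^ m}) :
    ι Sy gen < ι A' f₀ := by
  -- the canonical game at the position `(A', f₀)`
  obtain ⟨P, hP, -, -, -, -, n, u, w, hspan, hrk, -, -, hpres, -, hdrop⟩ := hgame k A' f₀ hf0 hf2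
  haveI := hP
  have hI' : ∀ m, weightedMonomialIdeal u w m = (Fch.ideal m).map (algebraMap A A') :=
    fun m => (hpres m).trans (hFJ m).symm
  have hu𝔪 : ∀ i, u i ∈ maximalIdeal A' := fun i => hspan ▸ Ideal.subset_span ⟨i, rfl⟩
  -- step 1: the game-side prime `𝔫'` and `g`
  obtain ⟨𝔫', h𝔫', g, hT', hmax, hV', hgv, hJmap⟩ := exists_prime_bridge 𝔮 Fch K₀ hK₀ 𝔫 hII hIII u w hu𝔪 hI'
  haveI := h𝔫'
  have hP' : P.map (algebraMap A' (cobordantAlgebra' u w)) ≤ 𝔫' :=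
    (Ideal.map_mono (IsLocalRing.le_maximalIdeal hP.ne_top)).trans hmax
  -- the factorisation `f₀ = (t⁻¹)ᵃ g₀`, `t⁻¹ ∤ g₀`, `σˢ((f₀)) = (g₀)`
  obtain ⟨a, g₀, hfg, hndvd, hst⟩ := exists_factor_strictTransform_eq u w hspan hrk hf0
  -- steps 2 and 3
  obtain ⟨hd1, hd2⟩ := dvd_and_dvd_of_saturation Fch K₀ 𝔫 u w 𝔫' g hgv hJmap hst Ψ₁ hI
  obtain ⟨hιeq, hsq⟩ := iota_eq_and_mem_sq_of_dvd_dvd ι hc6 hu Fch 𝔫 u w 𝔫' g Ψ₁ hgen2 _ hd1 hd2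
  -- (drop)
  rw [hιeq]
  exact hdrop 𝔫' hT' hP' hV' a g₀ hfg hndvd hsq

end ExcModel

end Summit.ResolutionOfSingularities.ResolutionOfSingularities.Cruxes.HypersurfaceCentreConstruction.LocalEngine

end
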